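import Summits.ValiantsHypothesis.ValiantsHypothesis.Theorems.SliceSignRankPolyaOneTwist
import Summits.ValiantsHypothesis.ValiantsHypothesis.Theorems.SliceSignRankSrkNotQPForsterSliceEquiv

/-!
# Route SliceSignRank — crux `SrkNotQP` (stmt-ValiantsHypothesis-20857), line `forster_slice`:
# the equivalence `stub_forsterSlice ⟺ (srk(n) ≥ (n!)^{1/C})`, unconditional form

`SliceSignRankSrkNotQPForsterSliceEquiv` proves the equivalence modulo Pólya's theorem taken as an
explicit hypothesis (to stay independent of the route file). This three-line file discharges that
hypothesis with the landed `polyaOneTwist_proof` (item `PolyaOneTwist`, stmt-ValiantsHypothesis-15123),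
giving the unconditional statement. Calibration only: both sides remain OPEN; `VP ≠ VNP` untouched.
-/

-- Sub = Summit layout duplicates the namespace component
set_option linter.dupNamespace false

namespace Summit.ValiantsHypothesis.ValiantsHypothesis.Theorems.SliceSignRank.SrkNotQP

/-- **`stub_forsterSlice` ⟺ factorial-power lower bound, unconditionally.** The registered stub of
line `forster_slice` (verbatim) holds iff there is `C` with `n! ≤ k^C` for every `k`-term real
sign-representation of `sgn` on `S_n`, `n ≥ 3` (i.e. `srk(n) ≥ (n!)^{1/C}`). Pólya's theorem is
supplied by the landed `polyaOneTwist_proof`. [this file] -/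
theorem forsterSlice_iff_factorialPowerLower' :
    (∃ C : ℕ, ∀ (n k : ℕ) (W : Fin k → Matrix (Fin n) (Fin n) ℝ),
      (∀ σ : Equiv.Perm (Fin n), 0 < ((Equiv.Perm.sign σ : ℤ) : ℝ) * ∑ t, ∏ i, W t (σ i) i) →
      ∃ V : Matrix (Fin n) (Fin n) ℝ, V.det ≠ 0 ∧
        (n.factorial : ℝ) * (Matrix.of fun i j => V i j ^ 2).permanent ≤ (k : ℝ) ^ C * V.det ^ 2) ↔
    (∃ C : ℕ, ∀ (n k : ℕ) (W : Fin k → Matrix (Fin n) (Fin n) ℝ), 3 ≤ n →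
      (∀ σ : Equiv.Perm (Fin n), 0 < ((Equiv.Perm.sign σ : ℤ) : ℝ) * ∑ t, ∏ i, W t (σ i) i) →
      n.factorial ≤ k ^ C) := by
  have hP := polyaOneTwist_proof
  unfold Theses.SliceSignRank.PolyaOneTwist at hP
  exact forsterSlice_iff_factorialPowerLower hP

end Summit.ValiantsHypothesis.ValiantsHypothesis.Theorems.SliceSignRank.SrkNotQP
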